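import Summits.Ventures.CertifiedManyBodySolver.Transport.ChainWindowMidpoint
import Summits.Ventures.CertifiedManyBodySolver.Transport.LTIPrimalHubbardChainKSDN
import HarnessLib

/-!
# Ventures/CertifiedManyBodySolver — Transport/ChainWindowSpinFlip.lean

Speedrun cell sr-mbsolver — LIT team (lit-1 gen-7), LEAD r118 (c) "STAGE 3", part B1: THE SPIN FLIP.
HONEST FRAMING: first certified bounds; not a superconductivity verdict; every number certified or labelled float.

The first generator of the identification group of op-08's `tl_marginal` problems is the spin flip `c_{x↑} ↔ c_{x↓}`
(`code/oplayer/fockspace.py`: `spin_flip = mode_permutation (p,o) ↦ (p,o^1)`, the Fock unitary `U|n⟩ = c†_{π m₁}⋯c†_{π m_r}|vac⟩`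
re-ordered, `U|vac⟩ = |vac⟩`). In the Jordan–Wigner / occupation basis of the tree (`siteOcc`: `|0⟩, |↑⟩, |↓⟩, |↑↓⟩`; same mode order
`(x,↑) < (x,↓) < (x+1,↑)` as fockspace's `m = 2p + orb`) it is the PRODUCT over the sites of the one-site signed swap
`u = |0⟩⟨0| + |↓⟩⟨↑| + |↑⟩⟨↓| − |↑↓⟩⟨↑↓|` (the sign: `c†_↓ c†_↑ |vac⟩ = −|↑↓⟩`), `spinFlipOp = ⨂_x u` — an explicit real
symmetric involution. This file proves that conjugation by it PRESERVES EVERY ROW of the ENT / `tl_marginal` by-value node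
(`EntTLMChainNode`): positivity, trace, local translation invariance (product unitaries commute with partial traces,
`spinPartialTrace_productOp_conj`), the `(N↑,N↓)`-sector zeros (`N_σ ∘ π = N_{σ̄}`), the site-averaged density `n_avg` and the
bond-averaged objective `h_avg` (both spin-symmetric: `u n_σ u = n_{σ̄}`, `u (c†_σF) u = c†_{σ̄}F`, `u c_σ u = c_{σ̄}`, …, sixteen-entry
identities), reality, the bound, and the entropy row (`entropy_sub_spinPartialTrace_productOp_conj`); and `spinFlipOp² = 1`.
With `ChainWindowMidpoint.lean`: `ρ ↦ ½(ρ + UρUᴴ)` is a feasible, spin-flip-invariant replacement of `ρ` with the same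
objective value. [cite: KullEtAl2024, §II.B, §VI.B] [cite: EsslerEtAl2005, §12.3.4 eqs. (12.196)–(12.201)]
-/

noncomputable section

open Matrix Complex
open scoped ComplexOrder BigOperators
open Literature.Probability.LatticeModels
open Literature.MathematicalPhysics.QuantumLattice
open Literature.MathematicalPhysics.QuantumLattice.HubbardWave0
open Literature.MathematicalPhysics.QuantumLattice.JordanWigner
open Literature.InformationTheory.Entropy (vonNeumannEntropy)

namespace Summit.Ventures.CertifiedManyBodySolver.Transport

/-! ### §1 The one-site spin flip `u` -/

section OneSite

/-- **The one-site spin flip** in the basis `|0⟩, |↑⟩, |↓⟩, |↑↓⟩`: `|0⟩ ↦ |0⟩`, `|↑⟩ ↦ |↓⟩`, `|↓⟩ ↦ |↑⟩`, `|↑↓⟩ ↦ −|↑↓⟩`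
(the Fock unitary of the mode permutation `↑ ↔ ↓` on one site: `c†_↓ c†_↑|vac⟩ = −c†_↑ c†_↓|vac⟩`).
[cite: EsslerEtAl2005, §12.3.4 eqs. (12.196)–(12.201)] -/
def uSpinFlip : Matrix (Fin 4) (Fin 4) ℂ := !![1, 0, 0, 0; 0, 0, 1, 0; 0, 1, 0, 0; 0, 0, 0, -1]

/-- `u` is a signed permutation: `u a b = [b = p a] · t a` with `p = (0 2 1 3)`, `t = (1, 1, 1, −1)`. [folklore] -/
theorem uSpinFlip_apply (a b : Fin 4) :
    uSpinFlip a b = if b = (![0, 2, 1, 3] : Fin 4 → Fin 4) a then (![1, 1, 1, -1] : Fin 4 → ℂ) a else 0 := by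
  fin_cases a <;> fin_cases b <;> simp [uSpinFlip]

/-- `u² = 1`. [folklore] -/
theorem uSpinFlip_mul_self : uSpinFlip * uSpinFlip = 1 := by
  ext a b; fin_cases a <;> fin_cases b <;> simp [uSpinFlip, Matrix.mul_apply, Fin.sum_univ_four]

/-- `uᴴ = u` (real symmetric). [folklore] -/
theorem uSpinFlip_conjTranspose : uSpinFlipᴴ = uSpinFlip := by
  ext a b; fin_cases a <;> fin_cases b <;> simp [uSpinFlip, Matrix.conjTranspose_apply]

/-- `u` is unitary. [folklore] -/
theorem uSpinFlip_mem_unitaryGroup : uSpinFlip ∈ Matrix.unitaryGroup (Fin 4) ℂ := by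
  rw [Matrix.mem_unitaryGroup_iff, Matrix.star_eq_conjTranspose, uSpinFlip_conjTranspose, uSpinFlip_mul_self]

/-- `u (c†_↑ F) u = c†_↓ F` and `u (c†_↓ F) u = c†_↑ F`. [cite: EsslerEtAl2005, §12.3.4 eqs. (12.198)–(12.201)] -/
theorem uSpinFlip_conj_siteCreation_mul_siteParity (σ : Fin 2) :
    uSpinFlip * (siteCreation σ * siteParity) * uSpinFlipᴴ = siteCreation σ.rev * siteParity := by
  rw [uSpinFlip_conjTranspose]
  have h0 : uSpinFlip * (siteCreation 0 * siteParity) * uSpinFlip = siteCreation 1 * siteParity := by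
    rw [siteCreation_zero_mul_siteParity, siteCreation_one_mul_siteParity]
    ext a b; fin_cases a <;> fin_cases b <;> simp [uSpinFlip, Matrix.mul_apply, Fin.sum_univ_four]
  have h1 : uSpinFlip * (siteCreation 1 * siteParity) * uSpinFlip = siteCreation 0 * siteParity := by
    rw [siteCreation_zero_mul_siteParity, siteCreation_one_mul_siteParity]
    ext a b; fin_cases a <;> fin_cases b <;> simp [uSpinFlip, Matrix.mul_apply, Fin.sum_univ_four]
  fin_cases σ
  · exact h0
  · exact h1

/-- `u c_σ u = c_{σ̄}`. [cite: EsslerEtAl2005, §12.3.4 eqs. (12.200)–(12.201)] -/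
theorem uSpinFlip_conj_siteAnnihilation (σ : Fin 2) :
    uSpinFlip * siteAnnihilation σ * uSpinFlipᴴ = siteAnnihilation σ.rev := by
  rw [uSpinFlip_conjTranspose]
  have h0 : uSpinFlip * siteAnnihilation 0 * uSpinFlip = siteAnnihilation 1 := by
    rw [siteAnnihilation_zero_eq, siteAnnihilation_one_eq]
    ext a b; fin_cases a <;> fin_cases b <;> simp [uSpinFlip, Matrix.mul_apply, Fin.sum_univ_four]
  have h1 : uSpinFlip * siteAnnihilation 1 * uSpinFlip = siteAnnihilation 0 := by
    rw [siteAnnihilation_zero_eq, siteAnnihilation_one_eq]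
    ext a b; fin_cases a <;> fin_cases b <;> simp [uSpinFlip, Matrix.mul_apply, Fin.sum_univ_four]
  fin_cases σ
  · exact h0
  · exact h1

/-- `u (F c_σ) u = F c_{σ̄}`. [cite: EsslerEtAl2005, §12.3.4 eqs. (12.198)–(12.201)] -/
theorem uSpinFlip_conj_siteParity_mul_siteAnnihilation (σ : Fin 2) :
    uSpinFlip * (siteParity * siteAnnihilation σ) * uSpinFlipᴴ = siteParity * siteAnnihilation σ.rev := by
  rw [uSpinFlip_conjTranspose]
  have h0 : uSpinFlip * (siteParity * siteAnnihilation 0) * uSpinFlip = siteParity * siteAnnihilation 1 := by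
    rw [siteParity_mul_siteAnnihilation_zero, siteParity_mul_siteAnnihilation_one]
    ext a b; fin_cases a <;> fin_cases b <;> simp [uSpinFlip, Matrix.mul_apply, Fin.sum_univ_four]
  have h1 : uSpinFlip * (siteParity * siteAnnihilation 1) * uSpinFlip = siteParity * siteAnnihilation 0 := by
    rw [siteParity_mul_siteAnnihilation_zero, siteParity_mul_siteAnnihilation_one]
    ext a b; fin_cases a <;> fin_cases b <;> simp [uSpinFlip, Matrix.mul_apply, Fin.sum_univ_four]
  fin_cases σ
  · exact h0
  · exact h1

/-- `u c†_σ u = c†_{σ̄}`. [cite: EsslerEtAl2005, §12.3.4 eq. (12.199)] -/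
theorem uSpinFlip_conj_siteCreation (σ : Fin 2) :
    uSpinFlip * siteCreation σ * uSpinFlipᴴ = siteCreation σ.rev := by
  rw [uSpinFlip_conjTranspose]
  have h0 : uSpinFlip * siteCreation 0 * uSpinFlip = siteCreation 1 := by
    rw [siteCreation_zero_eq, siteCreation_one_eq]
    ext a b; fin_cases a <;> fin_cases b <;> simp [uSpinFlip, Matrix.mul_apply, Fin.sum_univ_four]
  have h1 : uSpinFlip * siteCreation 1 * uSpinFlip = siteCreation 0 := by
    rw [siteCreation_zero_eq, siteCreation_one_eq]
    ext a b; fin_cases a <;> fin_cases b <;> simp [uSpinFlip, Matrix.mul_apply, Fin.sum_univ_four]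
  fin_cases σ
  · exact h0
  · exact h1

/-- `u (n_↑ n_↓) u = n_↑ n_↓`. [cite: EsslerEtAl2005, §12.3.4 eq. (12.196)] -/
theorem uSpinFlip_conj_siteDouble : uSpinFlip * siteDouble * uSpinFlipᴴ = siteDouble := by
  rw [uSpinFlip_conjTranspose, siteDouble_eq]
  ext a b; fin_cases a <;> fin_cases b <;> simp [uSpinFlip, Matrix.mul_apply, Fin.sum_univ_four]

/-- `n_↑ = diag(0,1,0,1)`. [cite: EsslerEtAl2005, §12.3.4 eq. (12.196)] -/
theorem siteNumber_zero_eq : siteNumber 0 = !![0, 0, 0, 0; 0, 1, 0, 0; 0, 0, 0, 0; 0, 0, 0, 1] := by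
  ext a b; fin_cases a <;> fin_cases b <;> simp [siteNumber, siteOcc]

/-- `n_↓ = diag(0,0,1,1)`. [cite: EsslerEtAl2005, §12.3.4 eq. (12.196)] -/
theorem siteNumber_one_eq : siteNumber 1 = !![0, 0, 0, 0; 0, 0, 0, 0; 0, 0, 1, 0; 0, 0, 0, 1] := by
  ext a b; fin_cases a <;> fin_cases b <;> simp [siteNumber, siteOcc]

/-- `u n_σ u = n_{σ̄}`. [cite: EsslerEtAl2005, §12.3.4 eq. (12.196)] -/
theorem uSpinFlip_conj_siteNumber (σ : Fin 2) :
    uSpinFlip * siteNumber σ * uSpinFlipᴴ = siteNumber σ.rev := by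
  rw [uSpinFlip_conjTranspose]
  have h0 : uSpinFlip * siteNumber 0 * uSpinFlip = siteNumber 1 := by
    rw [siteNumber_zero_eq, siteNumber_one_eq]
    ext a b; fin_cases a <;> fin_cases b <;> simp [uSpinFlip, Matrix.mul_apply, Fin.sum_univ_four]
  have h1 : uSpinFlip * siteNumber 1 * uSpinFlip = siteNumber 0 := by
    rw [siteNumber_zero_eq, siteNumber_one_eq]
    ext a b; fin_cases a <;> fin_cases b <;> simp [uSpinFlip, Matrix.mul_apply, Fin.sum_univ_four]
  fin_cases σ
  · exact h0
  · exact h1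

/-- The swap `p` exchanges the `↑` and `↓` occupations: `σ ∈ siteOcc (p a) ↔ σ̄ ∈ siteOcc a`. [folklore] -/
theorem mem_siteOcc_swap_iff (σ : Fin 2) (a : Fin 4) :
    σ ∈ siteOcc ((![0, 2, 1, 3] : Fin 4 → Fin 4) a) ↔ σ.rev ∈ siteOcc a := by
  fin_cases σ <;> fin_cases a <;> simp [siteOcc]

end OneSite

/-! ### §2 The window spin flip `U = ⨂_x u` -/

section Window

variable {Y : Type} [Fintype Y] [DecidableEq Y]

/-- `U² = 1` for `U = ⨂_x u`. [folklore] -/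
theorem spinFlip_mul_self : productOp (fun _ : Y => uSpinFlip) * productOp (fun _ : Y => uSpinFlip) = 1 := by
  rw [productOp_mul]
  simp only [uSpinFlip_mul_self, productOp_one]

omit [DecidableEq Y] in
/-- `Uᴴ = U`. [folklore] -/
theorem spinFlip_conjTranspose : (productOp (fun _ : Y => uSpinFlip))ᴴ = productOp (fun _ : Y => uSpinFlip) := by
  rw [productOp_conjTranspose]
  simp only [uSpinFlip_conjTranspose]

/-- `Uᴴ U = 1`. [folklore] -/
theorem spinFlip_conjTranspose_mul_self :
    (productOp (fun _ : Y => uSpinFlip))ᴴ * productOp (fun _ : Y => uSpinFlip) = 1 := by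
  rw [spinFlip_conjTranspose, spinFlip_mul_self]

omit [DecidableEq Y] in
/-- `U` is a signed permutation of configurations (`π k = p ∘ k`, sign `∏_x t(k_x)`). [folklore] -/
theorem spinFlip_apply (k l : TensorIndex Y 4) :
    productOp (fun _ : Y => uSpinFlip) k l =
      if l = (fun y => (![0, 2, 1, 3] : Fin 4 → Fin 4) (k y)) then ∏ y, (![1, 1, 1, -1] : Fin 4 → ℂ) (k y) else 0 :=
  productOp_apply_of_signedPerm (u := fun _ : Y => uSpinFlip) (fun _ => ![0, 2, 1, 3]) (fun _ => ![1, 1, 1, -1])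
    (fun _ a b => uSpinFlip_apply a b) k l

omit [DecidableEq Y] in
/-- The spin flip exchanges the counts `N_↑` and `N_↓` of a configuration. [folklore] -/
theorem sectorCount_spinFlip (σ : Fin 2) (k : TensorIndex Y 4) :
    (∑ x, if σ ∈ siteOcc ((![0, 2, 1, 3] : Fin 4 → Fin 4) (k x)) then 1 else 0 : ℕ) =
      ∑ x, if σ.rev ∈ siteOcc (k x) then 1 else 0 := by
  refine Finset.sum_congr rfl fun x _ => ?_
  rw [if_congr (mem_siteOcc_swap_iff σ (k x)) rfl rfl]

/-- **Sector zeros survive the spin flip.** [folklore] -/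
theorem spinFlip_sectorRow {ρ : Op Y 4}
    (hρ : ∀ σ : Fin 2, ∀ k k' : TensorIndex Y 4,
      (∑ x, if σ ∈ siteOcc (k x) then 1 else 0 : ℕ) ≠ (∑ x, if σ ∈ siteOcc (k' x) then 1 else 0 : ℕ) → ρ k k' = 0)
    (σ : Fin 2) (k k' : TensorIndex Y 4)
    (hk : (∑ x, if σ ∈ siteOcc (k x) then 1 else 0 : ℕ) ≠ (∑ x, if σ ∈ siteOcc (k' x) then 1 else 0 : ℕ)) :
    (productOp (fun _ : Y => uSpinFlip) * ρ * (productOp (fun _ : Y => uSpinFlip))ᴴ) k k' = 0 := by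
  refine sectorRow_signedPerm_conj (fun k y => (![0, 2, 1, 3] : Fin 4 → Fin 4) (k y)) _ spinFlip_apply
    (fun (σ : Fin 2) (k : TensorIndex Y 4) => (∑ x, if σ ∈ siteOcc (k x) then 1 else 0 : ℕ)) ?_ hρ σ k k' hk
  intro τ l l' hl
  refine ⟨τ.rev, ?_⟩
  rw [sectorCount_spinFlip, sectorCount_spinFlip, Fin.rev_rev]
  exact hl

/-- **Real entries survive the spin flip.** [folklore] -/
theorem spinFlip_realRow {ρ : Op Y 4} (hρ : ∀ k k', starRingEnd ℂ (ρ k k') = ρ k k') (k k' : TensorIndex Y 4) :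
    starRingEnd ℂ ((productOp (fun _ : Y => uSpinFlip) * ρ * (productOp (fun _ : Y => uSpinFlip))ᴴ) k k') =
      (productOp (fun _ : Y => uSpinFlip) * ρ * (productOp (fun _ : Y => uSpinFlip))ᴴ) k k' := by
  refine realRow_signedPerm_conj _ _ spinFlip_apply (fun l => ?_) hρ k k'
  rw [star_prod]
  refine Finset.prod_congr rfl fun y _ => ?_
  generalize l y = a
  fin_cases a <;> simp

/-- Positivity survives any conjugation. [folklore] -/
theorem conj_posSemidef {q : ℕ} (U : Op Y q) {ρ : Op Y q} (hρ : ρ.PosSemidef) : (U * ρ * Uᴴ).PosSemidef :=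
  hρ.mul_mul_conjTranspose_same U

/-- The trace survives conjugation by `U` with `Uᴴ U = 1`. [folklore] -/
theorem conj_trace {q : ℕ} {U : Op Y q} (hU : Uᴴ * U = 1) (ρ : Op Y q) : (U * ρ * Uᴴ).trace = ρ.trace := by
  rw [Matrix.trace_mul_cycle, hU, Matrix.one_mul]

/-- An expectation `tr(H · UρUᴴ)` equals `tr(H ρ)` when `Uᴴ H U = H`. [folklore] -/
theorem trace_mul_conj_of_invariant {q : ℕ} {U H : Op Y q} (hH : Uᴴ * H * U = H) (ρ : Op Y q) :
    (H * (U * ρ * Uᴴ)).trace = (H * ρ).trace := by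
  rw [show H * (U * ρ * Uᴴ) = (H * U * ρ) * Uᴴ by simp only [Matrix.mul_assoc], Matrix.trace_mul_cycle,
    show Uᴴ * (H * U) * ρ = (Uᴴ * H * U) * ρ by simp only [Matrix.mul_assoc], hH]

end Window

/-! ### §3 Conjugation bookkeeping: sums, scalars, products of on-site factors -/

section Conj

variable {Y : Type} [Fintype Y] [DecidableEq Y] {q : ℕ}

/-- `U (Σ_i A_i) V = Σ_i U A_i V`. [folklore] -/
theorem conj_sum {ι : Type} (s : Finset ι) (U V : Op Y q) (A : ι → Op Y q) :
    U * (∑ i ∈ s, A i) * V = ∑ i ∈ s, U * A i * V := by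
  rw [Finset.mul_sum, Finset.sum_mul]

/-- `U (c • A) V = c • U A V`. [folklore] -/
theorem conj_smul (c : ℂ) (U V A : Op Y q) : U * (c • A) * V = c • (U * A * V) := by
  rw [Matrix.mul_smul, Matrix.smul_mul]

/-- `U (A + B) V = U A V + U B V`. [folklore] -/
theorem conj_add (U V A B : Op Y q) : U * (A + B) * V = U * A * V + U * B * V := by
  rw [Matrix.mul_add, Matrix.add_mul]

/-- `(⨂u) (onSite x a · onSite y b) (⨂u)ᴴ = onSite x (u a uᴴ) · onSite y (u b uᴴ)` for a constant unitary family. [folklore] -/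
theorem spinFlip_conj_onSite_mul_onSite (x y : Y) (a b : Matrix (Fin 4) (Fin 4) ℂ) :
    productOp (fun _ : Y => uSpinFlip) * (onSite x a * onSite y b) * (productOp (fun _ : Y => uSpinFlip))ᴴ =
      onSite x (uSpinFlip * a * uSpinFlipᴴ) * onSite y (uSpinFlip * b * uSpinFlipᴴ) := by
  have hu : ∀ _ : Y, uSpinFlipᴴ * uSpinFlip = 1 := fun _ => by rw [uSpinFlip_conjTranspose, uSpinFlip_mul_self]
  have hu' : ∀ _ : Y, uSpinFlip * uSpinFlipᴴ = 1 := fun _ => by rw [uSpinFlip_conjTranspose, uSpinFlip_mul_self]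
  rw [productOp_conj_mul hu, productOp_conj_onSite hu', productOp_conj_onSite hu']

/-- `(⨂u) (onSite x a) (⨂u)ᴴ = onSite x (u a uᴴ)`. [folklore] -/
theorem spinFlip_conj_onSite (x : Y) (a : Matrix (Fin 4) (Fin 4) ℂ) :
    productOp (fun _ : Y => uSpinFlip) * onSite x a * (productOp (fun _ : Y => uSpinFlip))ᴴ =
      onSite x (uSpinFlip * a * uSpinFlipᴴ) :=
  productOp_conj_onSite (fun _ => by rw [uSpinFlip_conjTranspose, uSpinFlip_mul_self]) x a

/-- A `σ`-symmetric sum is unchanged by `σ ↦ σ̄`. [folklore] -/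
theorem sum_fin_two_rev {M : Type*} [AddCommMonoid M] (f : Fin 2 → M) : ∑ σ : Fin 2, f σ.rev = ∑ σ : Fin 2, f σ := by
  rw [Fin.sum_univ_two, Fin.sum_univ_two, add_comm]
  rfl

end Conj

/-! ### §4 The bond density in the product basis and its spin-flip invariance -/

section Bond

variable {Λ : Finset (Site 1)}

/-- Consecutive sites `x`, `y = x + 1` of a chain region are a covering pair of `PolySite Λ`. [folklore] -/
theorem pt_covBy_of_succ {x y : Site 1} (hx : x ∈ Λ) (hy : y ∈ Λ) (h : y 0 = x 0 + 1) :
    PolySite.pt x hx < PolySite.pt y hy ∧ ∀ z : PolySite Λ, PolySite.pt x hx < z → ¬ z < PolySite.pt y hy := by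
  refine ⟨?_, fun z h1 h2 => ?_⟩
  · rw [PolySite.lt_iff_apply, PolySite.ofLex_coe_pt, PolySite.ofLex_coe_pt]
    omega
  · rw [PolySite.lt_iff_apply, PolySite.ofLex_coe_pt] at h1 h2
    omega

/-- **The bond-centred density in the product basis** (`y = x + 1`):
`toSpin h_bond(x,y) = −t Σ_σ [(c†_σ F)_x (c_σ)_y + (F c_σ)_x (c†_σ)_y] + (U/2)[(n_↑n_↓)_x + (n_↑n_↓)_y]`.
[cite: EsslerEtAl2005, §12.3.4 eqs. (12.196)–(12.201)] -/
theorem toSpin_tlmBond_of_succ (t U : ℝ) {x y : Site 1} (hx : x ∈ Λ) (hy : y ∈ Λ) (h : y 0 = x 0 + 1) :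
    toSpin (tlmBond t U x y hx hy) =
      (-(t : ℂ)) • ∑ σ : Fin 2,
          (onSite (PolySite.pt x hx) (siteCreation σ * siteParity) * onSite (PolySite.pt y hy) (siteAnnihilation σ) +
            onSite (PolySite.pt x hx) (siteParity * siteAnnihilation σ) * onSite (PolySite.pt y hy) (siteCreation σ)) +
        ((U / 2 : ℝ) : ℂ) • (onSite (PolySite.pt x hx) siteDouble + onSite (PolySite.pt y hy) siteDouble) := by
  obtain ⟨hlt, hcov⟩ := pt_covBy_of_succ hx hy h
  rw [tlmBond, map_add, map_smul, map_smul, map_sum, map_add, nAt, nAt, nAt, nAt, toSpin_numberOp_mul_numberOp,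
    toSpin_numberOp_mul_numberOp]
  congr 2
  refine Finset.sum_congr rfl fun σ _ => ?_
  rw [map_add, cAt, cAt, annihilation_conjTranspose, annihilation_conjTranspose,
    toSpin_creation_mul_annihilation_of_covBy hlt hcov, toSpin_creation_mul_annihilation_of_covBy' hlt hcov]

/-- **The bond density is spin-flip invariant** (`y = x + 1`): `(⨂u) · toSpin h_bond(x,y) · (⨂u)ᴴ = toSpin h_bond(x,y)`.
[cite: EsslerEtAl2005, §12.3.4 eqs. (12.196)–(12.201)] -/
theorem spinFlip_conj_toSpin_tlmBond (t U : ℝ) {x y : Site 1} (hx : x ∈ Λ) (hy : y ∈ Λ) (h : y 0 = x 0 + 1) :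
    productOp (fun _ : PolySite Λ => uSpinFlip) * toSpin (tlmBond t U x y hx hy) *
        (productOp (fun _ : PolySite Λ => uSpinFlip))ᴴ = toSpin (tlmBond t U x y hx hy) := by
  rw [toSpin_tlmBond_of_succ t U hx hy h, conj_add, conj_smul, conj_smul, conj_sum, conj_add, spinFlip_conj_onSite,
    spinFlip_conj_onSite, uSpinFlip_conj_siteDouble]
  congr 2
  rw [← sum_fin_two_rev]
  refine Finset.sum_congr rfl fun σ _ => ?_
  rw [conj_add, spinFlip_conj_onSite_mul_onSite, spinFlip_conj_onSite_mul_onSite, uSpinFlip_conj_siteCreation_mul_siteParity,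
    uSpinFlip_conj_siteAnnihilation, uSpinFlip_conj_siteParity_mul_siteAnnihilation, uSpinFlip_conj_siteCreation, Fin.rev_rev]

end Bond

/-! ### §5 The rows of `EntTLMChainNode` under the spin flip (window `{-1, …, n+1}`) -/

section Rows

variable (n : ℕ)

/-- `x_{j+1} = x_j + 1`. [folklore] -/
theorem tlmSite_succ_apply (j : ℕ) : tlmSite (j + 1) 0 = tlmSite j 0 + 1 := by
  simp only [tlmSite]; push_cast; ring

/-- **`h_avg` is spin-flip invariant**: `(⨂u) · toSpin (tlmObjective t U n) · (⨂u)ᴴ = toSpin (tlmObjective t U n)`.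
[cite: KullEtAl2024, §II.B] [cite: EsslerEtAl2005, §12.3.4] -/
theorem spinFlip_conj_toSpin_tlmObjective (t U : ℝ) :
    productOp (fun _ : PolySite (chainWindow (-1) ((n : ℤ) + 1)) => uSpinFlip) * toSpin (tlmObjective t U n) *
        (productOp (fun _ : PolySite (chainWindow (-1) ((n : ℤ) + 1)) => uSpinFlip))ᴴ = toSpin (tlmObjective t U n) := by
  rw [tlmObjective, map_smul, map_sum, conj_smul, conj_sum]
  congr 1
  refine Finset.sum_congr rfl fun j _ => ?_
  exact spinFlip_conj_toSpin_tlmBond t U _ _ (tlmSite_succ_apply j)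

/-- **`n_avg` is spin-flip invariant**: `(⨂u) · toSpin (tlmDensity n) · (⨂u)ᴴ = toSpin (tlmDensity n)`. [cite: KullEtAl2024, §II.B] -/
theorem spinFlip_conj_toSpin_tlmDensity :
    productOp (fun _ : PolySite (chainWindow (-1) ((n : ℤ) + 1)) => uSpinFlip) * toSpin (tlmDensity n) *
        (productOp (fun _ : PolySite (chainWindow (-1) ((n : ℤ) + 1)) => uSpinFlip))ᴴ = toSpin (tlmDensity n) := by
  rw [tlmDensity, map_smul, map_sum, conj_smul, conj_sum]
  congr 1
  refine Finset.sum_congr rfl fun p _ => ?_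
  rw [map_sum, conj_sum, ← sum_fin_two_rev]
  refine Finset.sum_congr rfl fun σ _ => ?_
  rw [toSpin_numberOp, toSpin_numberOp, spinFlip_conj_onSite, uSpinFlip_conj_siteNumber, Fin.rev_rev]

/-- From `U H Uᴴ = H` and `Uᴴ = U`: `Uᴴ H U = H`. [folklore] -/
theorem spinFlip_conjTranspose_conj {Y : Type} [Fintype Y] [DecidableEq Y] {H : Op Y 4}
    (h : productOp (fun _ : Y => uSpinFlip) * H * (productOp (fun _ : Y => uSpinFlip))ᴴ = H) :
    (productOp (fun _ : Y => uSpinFlip))ᴴ * H * productOp (fun _ : Y => uSpinFlip) = H := by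
  rw [spinFlip_conjTranspose] at h ⊢
  exact h

/-- **The LTI row survives the spin flip.** [cite: KullEtAl2024, §II.B eq. (locTIn)] -/
theorem spinFlip_ltiRow {ρ : Op (PolySite (chainWindow (-1) ((n : ℤ) + 1))) 4}
    (hLTI : spinPartialTrace ((PolySite.affEmb 1 (unitVec 0) (chainWindow (-1) (n : ℤ))).trans
        (PolySite.incl (affShiftSet_chainWindow_subset (-1) (n : ℤ)))) ρ =
      spinPartialTrace (PolySite.incl (chainWindow_mono_right (-1) (by omega : (n : ℤ) ≤ n + 1))) ρ) :
    spinPartialTrace ((PolySite.affEmb 1 (unitVec 0) (chainWindow (-1) (n : ℤ))).trans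
        (PolySite.incl (affShiftSet_chainWindow_subset (-1) (n : ℤ))))
        (productOp (fun _ => uSpinFlip) * ρ * (productOp (fun _ => uSpinFlip))ᴴ) =
      spinPartialTrace (PolySite.incl (chainWindow_mono_right (-1) (by omega : (n : ℤ) ≤ n + 1)))
        (productOp (fun _ => uSpinFlip) * ρ * (productOp (fun _ => uSpinFlip))ᴴ) := by
  rw [spinPartialTrace_productOp_conj _ (fun _ => uSpinFlip_mem_unitaryGroup) ρ,
    spinPartialTrace_productOp_conj _ (fun _ => uSpinFlip_mem_unitaryGroup) ρ, hLTI]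

/-- **The density row survives the spin flip.** [cite: KullEtAl2024, §II.B] -/
theorem spinFlip_densityRow {ρ : Op (PolySite (chainWindow (-1) ((n : ℤ) + 1))) 4} {ν : ℝ}
    (hdens : ((toSpin (tlmDensity n) * ρ).trace).re = ν) :
    ((toSpin (tlmDensity n) * (productOp (fun _ => uSpinFlip) * ρ * (productOp (fun _ => uSpinFlip))ᴴ)).trace).re = ν := by
  rw [trace_mul_conj_of_invariant (spinFlip_conjTranspose_conj (spinFlip_conj_toSpin_tlmDensity n)), hdens]

/-- **The objective is spin-flip invariant.** [cite: KullEtAl2024, §II.B] -/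
theorem spinFlip_objective (t U : ℝ) (ρ : Op (PolySite (chainWindow (-1) ((n : ℤ) + 1))) 4) :
    ((toSpin (tlmObjective t U n) * (productOp (fun _ => uSpinFlip) * ρ * (productOp (fun _ => uSpinFlip))ᴴ)).trace).re =
      ((toSpin (tlmObjective t U n) * ρ).trace).re := by
  rw [trace_mul_conj_of_invariant (spinFlip_conjTranspose_conj (spinFlip_conj_toSpin_tlmObjective n t U))]

/-- **The entropy row survives the spin flip.** [cite: FawziFawziScalet2024Entropy, Theorem 4.1] -/
theorem spinFlip_entropyRow {ρ : Op (PolySite (chainWindow (-1) ((n : ℤ) + 1))) 4} (hρ : ρ.PosSemidef)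
    (hent : 0 ≤ vonNeumannEntropy ρ -
      vonNeumannEntropy (spinPartialTrace (PolySite.incl (chainWindow_mono_right (-1) (by omega : (n : ℤ) ≤ n + 1))) ρ)) :
    0 ≤ vonNeumannEntropy (productOp (fun _ => uSpinFlip) * ρ * (productOp (fun _ => uSpinFlip))ᴴ) -
      vonNeumannEntropy (spinPartialTrace (PolySite.incl (chainWindow_mono_right (-1) (by omega : (n : ℤ) ≤ n + 1)))
        (productOp (fun _ => uSpinFlip) * ρ * (productOp (fun _ => uSpinFlip))ᴴ)) := by
  rw [entropy_sub_spinPartialTrace_productOp_conj _ (fun _ => uSpinFlip_mem_unitaryGroup) hρ.1]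
  exact hent

/-- **`U² ρ U²ᴴ = ρ`** (so the midpoint `½(ρ + UρUᴴ)` is spin-flip invariant, `conj_midpoint_self`). [folklore] -/
theorem spinFlip_sq_conj {Y : Type} [Fintype Y] [DecidableEq Y] (ρ : Op Y 4) :
    (productOp (fun _ : Y => uSpinFlip) * productOp (fun _ : Y => uSpinFlip)) * ρ *
      (productOp (fun _ : Y => uSpinFlip) * productOp (fun _ : Y => uSpinFlip))ᴴ = ρ := by
  rw [spinFlip_mul_self, Matrix.conjTranspose_one, Matrix.one_mul, Matrix.mul_one]

end Rows

end Summit.Ventures.CertifiedManyBodySolver.Transport
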